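import Summits.QuantumFields.YangMills.Theorems.UnitScaleTiltProp7TransportedInterpolant
import Summits.QuantumFields.YangMills.Theorems.UnitScaleTiltProp7CoverTwistedChartSym
import Summits.QuantumFields.YangMills.Theorems.UnitScaleTiltProp7CoverCombLetters
import Literature.MathematicalPhysics.QuantumFieldTheory.BalabanImbrieJaffe1984to88.BIJ88RT51Background
import HarnessLib

/-!
# Route `UnitScaleTilt`, crux K1 «MinimiserStabilityRegPr» (stmt-QuantumFields-19200), EX face, K-storey — **(R6a) ROOM ROOT (c): THE TRANSPORTED INTERPOLANT's ROW (a)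
# `‖Q_k(U₀)(E c) − c‖ ≤ θ‖c‖` AT EVERY MEMBER, WITHOUT THE WRAP-AROUND ROOM** — px13 ✓`Prop7TransportedInterpolant.norm_Qk_interpolant_sub_le` with its antecedent
# `hwrap : 2(d(ℓ−1) + 8ℓ + 1) ≤ sitesPerDir 0` DELETED and the SAME `θ`, by READING THE ROW ON THE `L³`-FOLD COVER `F.cover 3` (which has the room): the explicit bump ⊗
# axial-transport field `A_C` is DECK-NATURAL (`Ã_{C∘π}(U₀∘π) = A_C(U₀) ∘ π`, §2 — in-block digits, block corners∕representatives and the block's axial gauge commute with the covering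
# map; the coarse datum is read through ✓`proj_siteShift`), `Q_k` commutes with the lift on `RegPr` (✓`Qk_cover`), and both sides of the cover's row are lifts, so they scale by the degree
# `(L³)³` (✓`norm_sq_toL2B_cover`).  ★★OWNER g36 14:08:01Z: after the R-editions this row's `hwrap` (px10 ✓`Prop7KinvEtaFamilyPackage.hwrap_of_room`) is the LAST source of the no-wrap ROOM
# antecedent on the EX display rows (1) `h133` ∕ (3) `h137kπ`.  (px5 g15 LOCATE evidence #57; px13 g16 ∕ px12 g18 «NOT MINE — GO»; ★★OWNER g36 GO; width seat `ym3-torus-px5` gen 15.)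

Cell `ym3-torus` (HUMAN RULING D-0037; rung R3 = SU(2) YM₃ on T³ — NOT d = 4, NOT infinite volume, NOT a mass gap, NOT Clay).  THEOREMS ONLY (0 `def`, 0 `sorry`, default heartbeats);
`--supports stmt-QuantumFields-19200 --as helper`; count-neutral.  The formula and `θ` are sliced VERBATIM from the tree statement (`g15/gen/gen_r6a.py`).

WHAT IS PROVED (ns `Summit.QuantumFields.YangMills.Theorems.Prop7TransportedInterpolantAllMembers`).
* §1 (any `P`, `k ≤ m + K`): `val_proj_mod_pow` (in-block digits are deck-invariant) · `proj_fibreSite` (block corners are natural) · ★`rel_corner_eq_digits` (the relative position from the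
  block corner IS the digit vector — NO room letter: `L^k ≤ N∕2` on every member, answering px13 g16 14:15:38Z) · ★★`axialT_corner_comp_projBond` (the block's axial gauge is natural:
  ✓`holT_comp_projBond` + digits).
* §2 `wrap_cover_three` (the `L³`-fold cover has the wrap room for every `n K`) · `projBond_bondShift_symm` · ★★`interpolantField_cover` (`Ã_{C∘π}(U₀∘π) = A_C(U₀) ∘ π`).
* §3 ★★★ **`norm_Qk_interpolant_sub_le_allMembers`** — ✓`norm_Qk_interpolant_sub_le` VERBATIM WITHOUT `hwrap` (same binders in the same order otherwise, same `θ`).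
HYP-SAT (★★OWNER RULING №42).  Exactly px13's minus the room: `RegPr F n K ε₀ U₀` (EX class), `10¹⁰L⁶ε₀ ≤ 1`, `10¹²L³ε₀ ≤ 1` (print's windows), profile letters `OWN > 0`, `T ≠ 0` (inhabited by
the skew ⊗ parabola² profile, ✓`Prop7TransportedInterpolantOfRegPr`); conclusion an explicit norm row; no `Prop` placeholder.
HONEST SCOPE.  A re-reading of px13's row on the cover; nothing of `exists_transportedInterpolant`'s editions (R6b), (K1b), K6, `h133`, EX `stub_existenceMinimalOrbit`, 19200 or the
rung is proved here; the Yang–Mills mass gap is NOT proved.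

References: T. Bałaban, CMP **99** (1985) 389–434 [Balaban1985BackgroundPropagators] ((3.13)–(3.16) p.393, (3.126)–(3.132) pp.420–422); CMP **95** (1984) 17–40 [Balaban1984PropagatorsI]
((1.6) p.18, (1.18) p.20, (1.47)–(1.50) p.26); CMP **98** (1985) 17–51 [Balaban1985Averaging] ((9) p.18, p.24); CMP **109** (1987) 249–301 [Balaban1987RG1] ((0.1)–(0.3) pp.251–252).
-/


set_option autoImplicit false

noncomputable section

open scoped BigOperators Matrix.Norms.L2Operator Matrix

namespace Summit.QuantumFields.YangMills.Theorems.Prop7TransportedInterpolantAllMembers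

open Literature.MathematicalPhysics.QuantumFieldTheory.Balaban1983to89
open Literature.MathematicalPhysics.QuantumFieldTheory.Balaban1983to89.T3ContinuumYM3Torus
open Literature.MathematicalPhysics.QuantumFieldTheory.BalabanImbrieJaffe1984to88.BIJ88RT51Background (iterBlockOf_embIter)
open Finset T4Continuum BlockAveraging LatticeFieldCalculus B1RG242Torus
open B5Eq118OneStroke (iterBlockOf val_iterBlockOf)
open B5Eq117TorusCarriers (sitesPerDir_zero_eq)
open B7Eq78Linearization (conjR)
open B9Eq311L2Pairing (WL2)
open B10Eq27TorusAxialLog (axialT rel rel_apply holT unitsField toUField suIncl)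
open B11Eq103H1Complex (BondL2K)
open B15DeterminingSets (embIter)
open T3LevelShift (bondShift siteShift)
open T3PrintedRegularOrbits (sites_eq)
open T3PrintedRegularMinimiser (RegPr)
open T3RegularMinimiser (regThreshold)
open T3SectALandauChart (eta)
open Summit.QuantumFields.YangMills.Theorems.Prop7SectET3Transport (periodsT3)
open Summit.QuantumFields.YangMills.Theorems.Prop7SectET3HilbertLetters (W₂ toL2 toL2B)
open Summit.QuantumFields.YangMills.Theorems.Prop7SectET3CurvedPropagators (Qk)
open Summit.QuantumFields.YangMills.Theorems.Prop7SymAvgTwSym (QTwS)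
open Summit.QuantumFields.YangMills.Theorems.Prop7TransverseRowOfTubeRowRegPr (Qk_toL2)
open Summit.QuantumFields.YangMills.Theorems.Prop7TransportedInterpolant (norm_Qk_interpolant_sub_le)
open Summit.QuantumFields.YangMills.Theorems.CoverSites
open Summit.QuantumFields.YangMills.Theorems.SmallMembersCoverLift (holT_comp_projBond regPr_cover_iff)
open Summit.QuantumFields.YangMills.Theorems.Prop7CoverCombLetters (proj_embIter)
open Summit.QuantumFields.YangMills.Theorems.Prop7CoverTwistedChartSym (proj_siteShift Qk_cover)
open Summit.QuantumFields.YangMills.Theorems.Prop7CoverQkc (norm_sq_toL2B_cover)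

/-! ## §1 The covering map and the in-block data of the formula -/

section Blocks

variable (P : Params) (jc : ℕ) {k : ℕ} (hk : k ≤ P.m + P.K)

include hk in
/-- **IN-BLOCK DIGITS ARE DECK-INVARIANT**: `(π x̃)_μ mod L^k = x̃_μ mod L^k` (`π` reduces labels modulo `N ∣`-multiple of `L^k`). [cite: Balaban1987RG1, (0.1) p.251] -/
theorem val_proj_mod_pow (x : Site (cover P jc) 0) (μ : Fin P.d) :
    (proj P jc 0 x μ).val % P.L ^ k = (x μ).val % P.L ^ k := by
  rw [val_proj]
  exact Nat.mod_mod_of_dvd _ (Dvd.intro _ (sitesPerDir_zero_eq (P := P) hk).symm)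

include hk in
/-- **THE BLOCK CORNER IS NATURAL**: `π (fibreSite 0 k B̃ r) = fibreSite 0 k (π B̃) r`. [cite: Balaban1987RG1, (0.1)–(0.3) pp.251–252] -/
theorem proj_fibreSite (B : Site (cover P jc) k) (r : Fin P.d → Fin (P.L ^ k)) :
    proj P jc 0 (Site.fibreSite 0 k B r) = Site.fibreSite 0 k (proj P jc k B) r := by
  funext μ
  rw [proj_apply]
  show ZMod.castHom (sitesPerDir_dvd P jc 0) (ZMod (P.sitesPerDir 0)) ((((B μ).val * (cover P jc).L ^ k + r μ : ℕ) : ZMod ((cover P jc).sitesPerDir 0)))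
    = (((proj P jc k B μ).val * P.L ^ k + r μ : ℕ) : ZMod (P.sitesPerDir 0))
  rw [map_natCast, val_proj, ZMod.natCast_eq_natCast_iff, sitesPerDir_zero_eq (P := P) hk]
  show (B μ).val * P.L ^ k + r μ ≡ (B μ).val % P.sitesPerDir k * P.L ^ k + r μ [MOD P.L ^ k * P.sitesPerDir k]
  rw [mul_comm (P.L ^ k) (P.sitesPerDir k)]
  exact Nat.ModEq.add_right _ ((Nat.mod_modEq _ _).symm.mul_right' _)

include hk in
/-- **THE RELATIVE POSITION OF A SITE FROM ITS BLOCK CORNER IS ITS DIGIT VECTOR** (no wrap: `L^k ≤ N∕2` on every member, `N = L^k·N_k`, `N_k ≥ 2`):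
`rel (fibreSite 0 k B 0) x = (x mod L^k)` whenever `B^k(x) = B`. [cite: Balaban1984PropagatorsI, (1.6) p.18, (1.18) p.20] -/
theorem rel_corner_eq_digits (x : Site P 0) (B : Site P k) (hB : iterBlockOf k x = B) :
    rel (Site.fibreSite 0 k B fun _ => (⟨0, pow_pos P.L_pos k⟩ : Fin (P.L ^ k))) x = fun ν => (((x ν).val % P.L ^ k : ℕ) : ℤ) := by
  subst hB
  have h0 := sitesPerDir_zero_eq (P := P) hk
  funext ν
  rw [rel_apply]
  set q : ℕ := (x ν).val / P.L ^ k with hq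
  set r : ℕ := (x ν).val % P.L ^ k with hr
  have hqr : (x ν).val = q * P.L ^ k + r := by rw [hq, hr]; exact (Nat.div_add_mod' _ _).symm
  have hc : (Site.fibreSite 0 k (iterBlockOf k x) (fun _ => (⟨0, pow_pos P.L_pos k⟩ : Fin (P.L ^ k))) ν)
      = (((q * P.L ^ k : ℕ)) : ZMod (P.sitesPerDir 0)) := by
    show ((((iterBlockOf k x ν).val * P.L ^ k + ((⟨0, pow_pos P.L_pos k⟩ : Fin (P.L ^ k)) : ℕ) : ℕ)) : ZMod (P.sitesPerDir 0)) = _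
    rw [val_iterBlockOf k hk x ν, ← hq]
    simp
  have hx : (x ν : ZMod (P.sitesPerDir 0)) = (((x ν).val : ℕ) : ZMod (P.sitesPerDir 0)) := (ZMod.natCast_zmod_val (x ν)).symm
  have hsub : x ν - Site.fibreSite 0 k (iterBlockOf k x) (fun _ => (⟨0, pow_pos P.L_pos k⟩ : Fin (P.L ^ k))) ν
      = ((r : ℕ) : ZMod (P.sitesPerDir 0)) := by
    rw [hc, hx, hqr]
    push_cast
    ring
  rw [hsub]
  apply ZMod.valMinAbs_natCast_of_le_half
  have h1 : r < P.L ^ k := Nat.mod_lt _ (pow_pos P.L_pos k)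
  have h2 : 2 ≤ P.sitesPerDir k := by
    unfold Params.sitesPerDir
    have : 1 ≤ P.L ^ (P.m + P.K - k) := Nat.one_le_pow _ _ P.L_pos
    omega
  have h3 : P.L ^ k ≤ P.sitesPerDir 0 / 2 := by
    rw [h0]
    calc P.L ^ k = P.L ^ k * 2 / 2 := by omega
      _ ≤ P.L ^ k * P.sitesPerDir k / 2 := Nat.div_le_div_right (Nat.mul_le_mul_left _ h2)
  exact h1.le.trans h3

include hk in
/-- ★ **THE BLOCK'S AXIAL GAUGE IS NATURAL UNDER THE COVER**: `axialT (V ∘ π) (corner B̃) x̃ = axialT V (corner (π B̃)) (π x̃)` for `x̃` in the block `B̃` — the comb word is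
the digit vector, which `π` preserves (`val_proj_mod_pow`), and transports along words commute with the lift (✓`holT_comp_projBond`). NO room letter: in-block offsets never wrap
on ANY member (`L^k ≤ N∕2`). [cite: Balaban1985Averaging, (9) p.18, p.24; Balaban1987RG1, (0.1) p.251] -/
theorem axialT_corner_comp_projBond {G : Type*} [Group G] (V : GaugeField P 0 G) (x : Site (cover P jc) 0) (B : Site (cover P jc) k)
    (hB : iterBlockOf k x = B) :
    axialT (V ∘ projBond P jc 0) (Site.fibreSite 0 k B fun _ => (⟨0, pow_pos (cover P jc).L_pos k⟩ : Fin ((cover P jc).L ^ k))) x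
      = axialT V (Site.fibreSite 0 k (proj P jc k B) fun _ => (⟨0, pow_pos P.L_pos k⟩ : Fin (P.L ^ k))) (proj P jc 0 x) := by
  have hkc : k ≤ (cover P jc).m + (cover P jc).K := by show k ≤ P.m + jc + P.K; omega
  have hB' : iterBlockOf k (proj P jc 0 x) = proj P jc k B := by rw [← hB, proj_iterBlockOf P jc k hk x]
  unfold axialT
  rw [holT_comp_projBond, proj_fibreSite P jc hk, rel_corner_eq_digits (cover P jc) hkc x B hB, rel_corner_eq_digits P hk (proj P jc 0 x) (proj P jc k B) hB']
  congr 2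
  funext ν
  show (((x ν).val % P.L ^ k : ℕ) : ℤ) = (((proj P jc 0 x ν).val % P.L ^ k : ℕ) : ℤ)
  rw [val_proj_mod_pow P jc hk]

end Blocks

/-! ## §2 The cover of a member: wrap room, coarse-bond identification, the interpolant formula is deck-natural -/

variable (F : T3Family) (jc n K : ℕ) (h : n ≤ K) (c₀ cB : ℝ) [Fact (0 < c₀)] [Fact (0 < cB)]

omit [Fact (0 < c₀)] [Fact (0 < cB)] in
/-- **THE `L³`-FOLD COVER HAS THE INTERPOLANT's WRAP-AROUND ROOM FOR EVERY `n K`**: `2(d(ℓ−1) + 8ℓ + 1) ≤ 2·L^{m+3+K}` (`d = 3`, `L ≥ 3`, `m ≥ 1`).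
[cite: Balaban1987RG1, (0.1)–(0.2) pp.251–252] -/
theorem wrap_cover_three :
    2 * (((F.cover 3).P K).d * (((F.cover 3).P K).L ^ (K - n) - 1) + 8 * ((F.cover 3).P K).L ^ (K - n) + 1) ≤ ((F.cover 3).P K).sitesPerDir 0 := by
  have hL3 : 3 ≤ F.L := by
    obtain ⟨⟨k, hk⟩, h1⟩ := F.hL
    omega
  have hm := F.hm
  show 2 * (3 * (F.L ^ (K - n) - 1) + 8 * F.L ^ (K - n) + 1) ≤ 2 * F.L ^ (F.m + 3 + K - 0)
  have hKn : F.L ^ (F.m + 3 + K - 0) = F.L ^ (F.m + 3 + K - (K - n)) * F.L ^ (K - n) := by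
    rw [← pow_add]; congr 1; omega
  have h81 : 81 ≤ F.L ^ (F.m + 3 + K - (K - n)) :=
    calc 81 = 3 ^ 4 := by norm_num
      _ ≤ F.L ^ 4 := Nat.pow_le_pow_left hL3 4
      _ ≤ F.L ^ (F.m + 3 + K - (K - n)) := Nat.pow_le_pow_right (by omega) (by omega)
  rw [hKn]
  have hx : 1 ≤ F.L ^ (K - n) := Nat.one_le_pow _ _ (by omega)
  have h3 := Nat.mul_le_mul_right (F.L ^ (K - n)) h81
  have h4 : 3 * (F.L ^ (K - n) - 1) ≤ 3 * F.L ^ (K - n) := Nat.mul_le_mul_left _ (Nat.sub_le _ _)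
  omega

omit [Fact (0 < c₀)] [Fact (0 < cB)] in
/-- **THE COARSE-BOND IDENTIFICATION COMMUTES WITH THE LIFT** (inverse direction of ✓`proj_siteShift`): `π_n ((bondShift)⁻¹ ⟨B̃, μ⟩) = (bondShift)⁻¹ ⟨π_K B̃, μ⟩`.
[cite: Balaban1987RG1, (0.1) p.251] -/
theorem projBond_bondShift_symm (B : Site ((F.cover jc).P K) (K - n)) (μ : Fin ((F.cover jc).P K).d) :
    projBond (F.P n) jc 0 ((bondShift (sites_eq (F.cover jc) n K h)).symm ⟨B, μ⟩) = (bondShift (sites_eq F n K h)).symm ⟨proj (F.P K) jc (K - n) B, μ⟩ := by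
  have hsrc : proj (F.P n) jc 0 ((siteShift (sites_eq (F.cover jc) n K h)).symm B) = (siteShift (sites_eq F n K h)).symm (proj (F.P K) jc (K - n) B) := by
    apply (siteShift (sites_eq F n K h)).injective
    rw [Equiv.apply_symm_apply, ← proj_siteShift F jc h, Equiv.apply_symm_apply]
  show (⟨proj (F.P n) jc 0 ((siteShift (sites_eq (F.cover jc) n K h)).symm B), μ⟩ : PBond (F.P n) 0) = ⟨(siteShift (sites_eq F n K h)).symm (proj (F.P K) jc (K - n) B), μ⟩
  rw [hsrc]

omit [Fact (0 < c₀)] [Fact (0 < cB)] in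
/-- … read at the block of a fine site: `π_n ((bondShift)⁻¹ ⟨B̃(x̃), μ⟩) = (bondShift)⁻¹ ⟨B(π x̃), μ⟩` (✓`proj_iterBlockOf`). [cite: Balaban1987RG1, (0.1)–(0.3) pp.251–252] -/
theorem projBond_bondShift_symm_block (xt : Site ((F.cover jc).P K) 0) (μ : Fin ((F.cover jc).P K).d) :
    projBond (F.P n) jc 0 ((bondShift (sites_eq (F.cover jc) n K h)).symm ⟨iterBlockOf (K - n) xt, μ⟩)
      = (bondShift (sites_eq F n K h)).symm ⟨iterBlockOf (K - n) (proj (F.P K) jc 0 xt), μ⟩ := by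
  have hk : K - n ≤ (F.P K).m + (F.P K).K := by show K - n ≤ F.m + K; omega
  rw [projBond_bondShift_symm F jc n K h]
  exact congrArg (fun s : Site (F.P K) (K - n) => (bondShift (sites_eq F n K h)).symm ⟨s, μ⟩) (proj_iterBlockOf (F.P K) jc (K - n) hk xt)

omit [Fact (0 < c₀)] [Fact (0 < cB)] in
/-- ★★ **THE TRANSPORTED-INTERPOLANT FIELD IS DECK-NATURAL**: the explicit bump ⊗ axial-transport field of ✓`Prop7TransportedInterpolant` (formula conjunct of
✓`exists_transportedInterpolant`) for the cover member `F.cover jc` at the lifted background `U₀ ∘ π` and the lifted coarse datum `C ∘ π` IS THE LIFT of the member's field at `(U₀, C)`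
— every ingredient is a function of the in-block digits of `b₋`, the block `B(b₋)`, its corner and representative, the two axial transports (`axialT_corner_comp_projBond`) and the
coarse datum at `⟨B(b₋), μ⟩` (`projBond_bondShift_symm`). [cite: Balaban1985BackgroundPropagators, (3.13)–(3.16) p.393; Balaban1984PropagatorsI, (1.18) p.20; Balaban1987RG1, (0.1)–(0.3) pp.251–252] -/
theorem interpolantField_cover (U₀ : GaugeField (F.P K) 0 (Matrix.specialUnitaryGroup (Fin 2) ℂ)) (p τ : ℕ → ℝ) (C : PBond (F.P n) 0 → Matrix (Fin 2) (Fin 2) ℂ) :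
    (fun bt : PBond ((F.cover jc).P K) 0 =>
        (p ((bt.src bt.dir).val % ((F.cover jc).P K).L ^ (K - n)) * ∏ ν ∈ univ.erase bt.dir, τ ((bt.src ν).val % ((F.cover jc).P K).L ^ (K - n)))
          • conjR (Unitary.toUnits (suIncl ((axialT (U₀ ∘ projBond (F.P K) jc 0) (Site.fibreSite 0 (K - n) (iterBlockOf (K - n) bt.src) fun _ => (⟨0, pow_pos ((F.cover jc).P K).L_pos (K - n)⟩ : Fin (((F.cover jc).P K).L ^ (K - n))))) bt.src)))⁻¹
              ((((∑ s ∈ range (((F.cover jc).P K).L ^ (K - n)), ((s : ℝ) + 1) * p s) * (∑ a ∈ range (((F.cover jc).P K).L ^ (K - n)), τ a) ^ (((F.cover jc).P K).d - 1)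
                  * (((((F.cover jc).P K).L : ℝ) ^ (((F.cover jc).P K).d + 1)) ^ (K - n))⁻¹)⁻¹)
                • conjR (axialT (unitsField (toUField (U₀ ∘ projBond (F.P K) jc 0))) (Site.fibreSite 0 (K - n) (iterBlockOf (K - n) bt.src) fun _ => (⟨0, pow_pos ((F.cover jc).P K).L_pos (K - n)⟩ : Fin (((F.cover jc).P K).L ^ (K - n)))) (embIter (K - n) (iterBlockOf (K - n) bt.src)))
                  ((C ∘ projBond (F.P n) jc 0) ((bondShift (sites_eq (F.cover jc) n K h)).symm ⟨iterBlockOf (K - n) bt.src, bt.dir⟩))))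
      = (fun b : PBond (F.P K) 0 =>
        (p ((b.src b.dir).val % (F.P K).L ^ (K - n)) * ∏ ν ∈ univ.erase b.dir, τ ((b.src ν).val % (F.P K).L ^ (K - n)))
          • conjR (Unitary.toUnits (suIncl ((axialT U₀ (Site.fibreSite 0 (K - n) (iterBlockOf (K - n) b.src) fun _ => (⟨0, pow_pos (F.P K).L_pos (K - n)⟩ : Fin ((F.P K).L ^ (K - n))))) b.src)))⁻¹
              ((((∑ s ∈ range ((F.P K).L ^ (K - n)), ((s : ℝ) + 1) * p s) * (∑ a ∈ range ((F.P K).L ^ (K - n)), τ a) ^ ((F.P K).d - 1)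
                  * ((((F.P K).L : ℝ) ^ ((F.P K).d + 1)) ^ (K - n))⁻¹)⁻¹)
                • conjR (axialT (unitsField (toUField U₀)) (Site.fibreSite 0 (K - n) (iterBlockOf (K - n) b.src) fun _ => (⟨0, pow_pos (F.P K).L_pos (K - n)⟩ : Fin ((F.P K).L ^ (K - n)))) (embIter (K - n) (iterBlockOf (K - n) b.src)))
                  (C ((bondShift (sites_eq F n K h)).symm ⟨iterBlockOf (K - n) b.src, b.dir⟩)))) ∘ projBond (F.P K) jc 0 := by
  classical
  have hk : K - n ≤ (F.P K).m + (F.P K).K := by show K - n ≤ F.m + K; omega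
  have hkc : K - n ≤ ((F.cover jc).P K).m + ((F.cover jc).P K).K := by show K - n ≤ F.m + jc + K; omega
  funext bt
  simp only [Function.comp_apply]
  -- the bond downstairs and its block
  have hsrc : (projBond (F.P K) jc 0 bt).src = proj (F.P K) jc 0 bt.src := rfl
  have hdir : (projBond (F.P K) jc 0 bt).dir = bt.dir := rfl
  have hblk : iterBlockOf (K - n) (proj (F.P K) jc 0 bt.src) = proj (F.P K) jc (K - n) (iterBlockOf (K - n) bt.src) :=
    (proj_iterBlockOf (F.P K) jc (K - n) hk bt.src).symm
  rw [hsrc, hdir]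
  -- (1) the scalar profile: in-block digits
  have hdig : ∀ ν, (proj (F.P K) jc 0 bt.src ν).val % (F.P K).L ^ (K - n) = (bt.src ν).val % ((F.cover jc).P K).L ^ (K - n) :=
    fun ν => val_proj_mod_pow (F.P K) jc hk bt.src ν
  simp only [hdig]
  -- (2) the two axial transports (restated in the goal's own syntax, then rewritten)
  have hax1 : axialT (U₀ ∘ projBond (F.P K) jc 0) (Site.fibreSite 0 (K - n) (iterBlockOf (K - n) bt.src) fun _ => (⟨0, pow_pos ((F.cover jc).P K).L_pos (K - n)⟩ : Fin (((F.cover jc).P K).L ^ (K - n)))) bt.src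
      = axialT U₀ (Site.fibreSite 0 (K - n) (proj (F.P K) jc (K - n) (iterBlockOf (K - n) bt.src)) fun _ => (⟨0, pow_pos (F.P K).L_pos (K - n)⟩ : Fin ((F.P K).L ^ (K - n)))) (proj (F.P K) jc 0 bt.src) :=
    axialT_corner_comp_projBond (F.P K) jc hk U₀ bt.src (iterBlockOf (K - n) bt.src) rfl
  have hax2 : axialT (unitsField (toUField (U₀ ∘ projBond (F.P K) jc 0))) (Site.fibreSite 0 (K - n) (iterBlockOf (K - n) bt.src) fun _ => (⟨0, pow_pos ((F.cover jc).P K).L_pos (K - n)⟩ : Fin (((F.cover jc).P K).L ^ (K - n)))) (embIter (K - n) (iterBlockOf (K - n) bt.src))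
      = axialT (unitsField (toUField U₀)) (Site.fibreSite 0 (K - n) (proj (F.P K) jc (K - n) (iterBlockOf (K - n) bt.src)) fun _ => (⟨0, pow_pos (F.P K).L_pos (K - n)⟩ : Fin ((F.P K).L ^ (K - n)))) (embIter (K - n) (proj (F.P K) jc (K - n) (iterBlockOf (K - n) bt.src))) := by
    have e := axialT_corner_comp_projBond (F.P K) jc hk (unitsField (toUField U₀)) (embIter (K - n) (iterBlockOf (K - n) bt.src)) (iterBlockOf (K - n) bt.src)
      (iterBlockOf_embIter (K - n) hkc _)
    rw [proj_embIter (K - n) hk] at e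
    exact e
  -- (3) the coarse datum, then the block of `π b̃₋`; the two members' `Params` letters agree definitionally (`rfl`)
  rw [hax1, hax2, projBond_bondShift_symm_block F jc n K h, hblk]
  rfl

/-! ## §3 ★★★ Row (a) of the transported interpolant at every member -/

/-- ★★★ **ROW (a) FOR THE TRANSPORTED INTERPOLANT FIELD AT EVERY MEMBER — NO WRAP-AROUND ROOM** ([Balaban1985BackgroundPropagators] (3.13)–(3.16); px13 ✓`norm_Qk_interpolant_sub_le`
with `hwrap` DELETED, SAME `θ`): `RegPr F n K ε₀ U₀`, `10¹⁰L⁶ε₀ ≤ 1`, `10¹²L³ε₀ ≤ 1`, `OWN > 0`, `T ≠ 0` ⟹ `‖Q_k(U₀)(toL2 A_C) − toL2B C‖ ≤ θ·‖toL2B C‖` for every coarse datum `C`.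
PROOF: the cover member `F.cover 3` has the wrap room (`wrap_cover_three`) and is regular (✓`regPr_cover_iff`), so the tree's row holds there for `(U₀ ∘ π, C ∘ π)`; its field is the
lift of the member's (`interpolantField_cover`), `Q_k` commutes with the lift (✓`Qk_cover`, ✓`Qk_toL2`), and both sides scale by the degree `(L³)³` (✓`norm_sq_toL2B_cover`).
[cite: Balaban1985BackgroundPropagators, (3.13)–(3.16) p.393, (3.132) p.422; Balaban1984PropagatorsI, (1.18) p.20, (1.47)–(1.50) p.26; Balaban1987RG1, (0.1)–(0.2) pp.251–252] -/
theorem norm_Qk_interpolant_sub_le_allMembers {ε₀ : ℝ} (hε₀ : 0 < ε₀) (hε : 10 ^ 10 * (F.L : ℝ) ^ 6 * ε₀ ≤ 1) (hε12 : 10 ^ 12 * (F.L : ℝ) ^ 3 * ε₀ ≤ 1)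
    (U₀ : GaugeField (F.P K) 0 (Matrix.specialUnitaryGroup (Fin 2) ℂ)) (hreg : RegPr F n K ε₀ U₀) (p τ : ℕ → ℝ)
    (hOWN : 0 < ∑ s ∈ range ((F.P K).L ^ (K - n)), ((s : ℝ) + 1) * p s) (hT : (∑ a ∈ range ((F.P K).L ^ (K - n)), τ a) ≠ 0)
    (C : PBond (F.P n) 0 → Matrix (Fin 2) (Fin 2) ℂ) :
    ‖Qk F n K h c₀ cB U₀ (toL2 F K c₀ (fun b : PBond (F.P K) 0 =>
        (p ((b.src b.dir).val % (F.P K).L ^ (K - n)) * ∏ ν ∈ univ.erase b.dir, τ ((b.src ν).val % (F.P K).L ^ (K - n)))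
          • conjR (Unitary.toUnits (suIncl ((axialT U₀ (Site.fibreSite 0 (K - n) (iterBlockOf (K - n) b.src) fun _ => (⟨0, pow_pos (F.P K).L_pos (K - n)⟩ : Fin ((F.P K).L ^ (K - n))))) b.src)))⁻¹
              ((((∑ s ∈ range ((F.P K).L ^ (K - n)), ((s : ℝ) + 1) * p s) * (∑ a ∈ range ((F.P K).L ^ (K - n)), τ a) ^ ((F.P K).d - 1)
                  * ((((F.P K).L : ℝ) ^ ((F.P K).d + 1)) ^ (K - n))⁻¹)⁻¹)
                • conjR (axialT (unitsField (toUField U₀)) (Site.fibreSite 0 (K - n) (iterBlockOf (K - n) b.src) fun _ => (⟨0, pow_pos (F.P K).L_pos (K - n)⟩ : Fin ((F.P K).L ^ (K - n)))) (embIter (K - n) (iterBlockOf (K - n) b.src)))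
                  (C ((bondShift (sites_eq F n K h)).symm ⟨iterBlockOf (K - n) b.src, b.dir⟩)))))
        - toL2B F n cB C‖
      ≤ (|∑ s ∈ range ((F.P K).L ^ (K - n)), ((((F.P K).L ^ (K - n) : ℕ) : ℝ) - 1 - (s : ℝ)) * p s| / (∑ s ∈ range ((F.P K).L ^ (K - n)), ((s : ℝ) + 1) * p s)
          + Real.sqrt (2 * (F.P K).d
              * (4 * (3 * 10 ^ 10 * (F.L : ℝ) ^ 10 * ε₀ ^ 2
                  + 192 * ((F.L : ℝ) ^ (K - n) * (2 * regThreshold F n K ε₀ * (((((F.P K).d * ((F.P K).L ^ (K - n) - 1) : ℕ)) : ℝ) + 7 * (F.L : ℝ) ^ (K - n)))) ^ 2))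
              * (cB / (c₀ * ((F.L : ℝ) ^ (K - n)) ^ (F.P K).d))
              * (c₀ * ((((∑ s ∈ range ((F.P K).L ^ (K - n)), ((s : ℝ) + 1) * p s) * (∑ a ∈ range ((F.P K).L ^ (K - n)), τ a) ^ ((F.P K).d - 1)
                  * ((((F.P K).L : ℝ) ^ ((F.P K).d + 1)) ^ (K - n))⁻¹)⁻¹) ^ 2
                  * ((∑ a : Fin ((F.P K).L ^ (K - n)), p a ^ 2) * (∑ a : Fin ((F.P K).L ^ (K - n)), τ a ^ 2) ^ ((F.P K).d - 1))) * cB⁻¹)))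
        * ‖toL2B F n cB C‖ := by
  classical
  have hL0 : (0 : ℝ) < (F.L : ℝ) := by exact_mod_cast F.hL.2.le.trans_lt' (by norm_num)
  have hdeg : (0 : ℝ) < ((F.L : ℝ) ^ 3) ^ 3 := by positivity
  -- the member's field and the two vectors downstairs
  set A : PBond (F.P K) 0 → Matrix (Fin 2) (Fin 2) ℂ := (fun b : PBond (F.P K) 0 =>
        (p ((b.src b.dir).val % (F.P K).L ^ (K - n)) * ∏ ν ∈ univ.erase b.dir, τ ((b.src ν).val % (F.P K).L ^ (K - n)))
          • conjR (Unitary.toUnits (suIncl ((axialT U₀ (Site.fibreSite 0 (K - n) (iterBlockOf (K - n) b.src) fun _ => (⟨0, pow_pos (F.P K).L_pos (K - n)⟩ : Fin ((F.P K).L ^ (K - n))))) b.src)))⁻¹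
              ((((∑ s ∈ range ((F.P K).L ^ (K - n)), ((s : ℝ) + 1) * p s) * (∑ a ∈ range ((F.P K).L ^ (K - n)), τ a) ^ ((F.P K).d - 1)
                  * ((((F.P K).L : ℝ) ^ ((F.P K).d + 1)) ^ (K - n))⁻¹)⁻¹)
                • conjR (axialT (unitsField (toUField U₀)) (Site.fibreSite 0 (K - n) (iterBlockOf (K - n) b.src) fun _ => (⟨0, pow_pos (F.P K).L_pos (K - n)⟩ : Fin ((F.P K).L ^ (K - n)))) (embIter (K - n) (iterBlockOf (K - n) b.src)))
                  (C ((bondShift (sites_eq F n K h)).symm ⟨iterBlockOf (K - n) b.src, b.dir⟩)))) with hA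
  -- THE COVER `F.cover 3`: regular, with wrap room; the tree's row there for the lifted data
  have hregt : RegPr (F.cover 3) n K ε₀ (U₀ ∘ projBond (F.P K) 3 0) := (regPr_cover_iff 3 F ε₀ U₀).mpr hreg
  have hcov := norm_Qk_interpolant_sub_le (F.cover 3) n K h c₀ cB hε₀ hε hε12 (U₀ ∘ projBond (F.P K) 3 0) hregt p τ hOWN hT
    (wrap_cover_three F n K) (C ∘ projBond (F.P n) 3 0)
  -- degrees: both vectors downstairs lift with `‖X̃∘π‖ = √((L³)³)·‖X̃‖`
  have hs : 0 < Real.sqrt (((F.L : ℝ) ^ 3) ^ 3) := Real.sqrt_pos.mpr hdeg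
  have e1 : ‖toL2B (F.cover 3) n cB (((((eta F n K : ℝ) : ℂ)) • QTwS F n K h U₀ A - C) ∘ projBond (F.P n) 3 0)‖
      = Real.sqrt (((F.L : ℝ) ^ 3) ^ 3) * ‖toL2B F n cB ((((eta F n K : ℝ) : ℂ)) • QTwS F n K h U₀ A - C)‖ := by
    rw [← Real.sqrt_sq (norm_nonneg (toL2B (F.cover 3) n cB _)), norm_sq_toL2B_cover F 3, Real.sqrt_mul hdeg.le, Real.sqrt_sq (norm_nonneg _)]
  have e2 : ‖toL2B (F.cover 3) n cB (C ∘ projBond (F.P n) 3 0)‖ = Real.sqrt (((F.L : ℝ) ^ 3) ^ 3) * ‖toL2B F n cB C‖ := by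
    rw [← Real.sqrt_sq (norm_nonneg (toL2B (F.cover 3) n cB _)), norm_sq_toL2B_cover F 3, Real.sqrt_mul hdeg.le, Real.sqrt_sq (norm_nonneg _)]
  -- the cover's field is the lift of `A` (this file's syntax), and `Q_k` commutes with the lift
  have hfield : toL2 (F.cover 3) K c₀ (fun bt : PBond ((F.cover 3).P K) 0 =>
        (p ((bt.src bt.dir).val % ((F.cover 3).P K).L ^ (K - n)) * ∏ ν ∈ univ.erase bt.dir, τ ((bt.src ν).val % ((F.cover 3).P K).L ^ (K - n)))
          • conjR (Unitary.toUnits (suIncl ((axialT (U₀ ∘ projBond (F.P K) 3 0) (Site.fibreSite 0 (K - n) (iterBlockOf (K - n) bt.src) fun _ => (⟨0, pow_pos ((F.cover 3).P K).L_pos (K - n)⟩ : Fin (((F.cover 3).P K).L ^ (K - n))))) bt.src)))⁻¹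
              ((((∑ s ∈ range (((F.cover 3).P K).L ^ (K - n)), ((s : ℝ) + 1) * p s) * (∑ a ∈ range (((F.cover 3).P K).L ^ (K - n)), τ a) ^ (((F.cover 3).P K).d - 1)
                  * (((((F.cover 3).P K).L : ℝ) ^ (((F.cover 3).P K).d + 1)) ^ (K - n))⁻¹)⁻¹)
                • conjR (axialT (unitsField (toUField (U₀ ∘ projBond (F.P K) 3 0))) (Site.fibreSite 0 (K - n) (iterBlockOf (K - n) bt.src) fun _ => (⟨0, pow_pos ((F.cover 3).P K).L_pos (K - n)⟩ : Fin (((F.cover 3).P K).L ^ (K - n)))) (embIter (K - n) (iterBlockOf (K - n) bt.src)))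
                  ((C ∘ projBond (F.P n) 3 0) ((bondShift (sites_eq (F.cover 3) n K h)).symm ⟨iterBlockOf (K - n) bt.src, bt.dir⟩))))
      = toL2 (F.cover 3) K c₀ (A ∘ projBond (F.P K) 3 0) := by
    rw [interpolantField_cover F 3 n K h U₀ p τ C, ← hA]
    rfl
  have hQ : Qk (F.cover 3) n K h c₀ cB (U₀ ∘ projBond (F.P K) 3 0) (toL2 (F.cover 3) K c₀ (A ∘ projBond (F.P K) 3 0))
      = (((eta F n K : ℝ) : ℂ)) • toL2B (F.cover 3) n cB (QTwS F n K h U₀ A ∘ projBond (F.P n) 3 0) :=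
    Qk_cover F 3 h hε₀ hε12 U₀ hreg A
  -- `η•toL2B(Q∘π) − toL2B(C∘π) = toL2B((η•Q − C)∘π)` upstairs, `Q_k(toL2 A) − toL2B C = toL2B(η•Q − C)` downstairs
  have hvec : (((eta F n K : ℝ) : ℂ)) • toL2B (F.cover 3) n cB (QTwS F n K h U₀ A ∘ projBond (F.P n) 3 0) - toL2B (F.cover 3) n cB (C ∘ projBond (F.P n) 3 0)
      = toL2B (F.cover 3) n cB (((((eta F n K : ℝ) : ℂ)) • QTwS F n K h U₀ A - C) ∘ projBond (F.P n) 3 0) := by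
    rw [← map_smul, ← map_sub]; rfl
  have hv : Qk (F.cover 3) n K h c₀ cB (U₀ ∘ projBond (F.P K) 3 0) (toL2 (F.cover 3) K c₀ (fun bt : PBond ((F.cover 3).P K) 0 =>
        (p ((bt.src bt.dir).val % ((F.cover 3).P K).L ^ (K - n)) * ∏ ν ∈ univ.erase bt.dir, τ ((bt.src ν).val % ((F.cover 3).P K).L ^ (K - n)))
          • conjR (Unitary.toUnits (suIncl ((axialT (U₀ ∘ projBond (F.P K) 3 0) (Site.fibreSite 0 (K - n) (iterBlockOf (K - n) bt.src) fun _ => (⟨0, pow_pos ((F.cover 3).P K).L_pos (K - n)⟩ : Fin (((F.cover 3).P K).L ^ (K - n))))) bt.src)))⁻¹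
              ((((∑ s ∈ range (((F.cover 3).P K).L ^ (K - n)), ((s : ℝ) + 1) * p s) * (∑ a ∈ range (((F.cover 3).P K).L ^ (K - n)), τ a) ^ (((F.cover 3).P K).d - 1)
                  * (((((F.cover 3).P K).L : ℝ) ^ (((F.cover 3).P K).d + 1)) ^ (K - n))⁻¹)⁻¹)
                • conjR (axialT (unitsField (toUField (U₀ ∘ projBond (F.P K) 3 0))) (Site.fibreSite 0 (K - n) (iterBlockOf (K - n) bt.src) fun _ => (⟨0, pow_pos ((F.cover 3).P K).L_pos (K - n)⟩ : Fin (((F.cover 3).P K).L ^ (K - n)))) (embIter (K - n) (iterBlockOf (K - n) bt.src)))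
                  ((C ∘ projBond (F.P n) 3 0) ((bondShift (sites_eq (F.cover 3) n K h)).symm ⟨iterBlockOf (K - n) bt.src, bt.dir⟩)))))
        - toL2B (F.cover 3) n cB (C ∘ projBond (F.P n) 3 0)
      = toL2B (F.cover 3) n cB (((((eta F n K : ℝ) : ℂ)) • QTwS F n K h U₀ A - C) ∘ projBond (F.P n) 3 0) := by
    rw [hfield, hQ, hvec]
  have hmem : Qk F n K h c₀ cB U₀ (toL2 F K c₀ A) - toL2B F n cB C = toL2B F n cB ((((eta F n K : ℝ) : ℂ)) • QTwS F n K h U₀ A - C) := by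
    rw [Qk_toL2, ← map_smul, ← map_sub]
  -- THE READING: the cover's row transported downstairs (`θ(F.cover 3) ≡ θ(F)` definitionally)
  have step : ∀ t : ℝ,
      ‖Qk (F.cover 3) n K h c₀ cB (U₀ ∘ projBond (F.P K) 3 0) (toL2 (F.cover 3) K c₀ (fun bt : PBond ((F.cover 3).P K) 0 =>
        (p ((bt.src bt.dir).val % ((F.cover 3).P K).L ^ (K - n)) * ∏ ν ∈ univ.erase bt.dir, τ ((bt.src ν).val % ((F.cover 3).P K).L ^ (K - n)))
          • conjR (Unitary.toUnits (suIncl ((axialT (U₀ ∘ projBond (F.P K) 3 0) (Site.fibreSite 0 (K - n) (iterBlockOf (K - n) bt.src) fun _ => (⟨0, pow_pos ((F.cover 3).P K).L_pos (K - n)⟩ : Fin (((F.cover 3).P K).L ^ (K - n))))) bt.src)))⁻¹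
              ((((∑ s ∈ range (((F.cover 3).P K).L ^ (K - n)), ((s : ℝ) + 1) * p s) * (∑ a ∈ range (((F.cover 3).P K).L ^ (K - n)), τ a) ^ (((F.cover 3).P K).d - 1)
                  * (((((F.cover 3).P K).L : ℝ) ^ (((F.cover 3).P K).d + 1)) ^ (K - n))⁻¹)⁻¹)
                • conjR (axialT (unitsField (toUField (U₀ ∘ projBond (F.P K) 3 0))) (Site.fibreSite 0 (K - n) (iterBlockOf (K - n) bt.src) fun _ => (⟨0, pow_pos ((F.cover 3).P K).L_pos (K - n)⟩ : Fin (((F.cover 3).P K).L ^ (K - n)))) (embIter (K - n) (iterBlockOf (K - n) bt.src)))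
                  ((C ∘ projBond (F.P n) 3 0) ((bondShift (sites_eq (F.cover 3) n K h)).symm ⟨iterBlockOf (K - n) bt.src, bt.dir⟩)))))
          - toL2B (F.cover 3) n cB (C ∘ projBond (F.P n) 3 0)‖ ≤ t * ‖toL2B (F.cover 3) n cB (C ∘ projBond (F.P n) 3 0)‖ →
      ‖Qk F n K h c₀ cB U₀ (toL2 F K c₀ A) - toL2B F n cB C‖ ≤ t * ‖toL2B F n cB C‖ := by
    intro t ht
    rw [hv, e1, e2] at ht
    rw [hmem]
    exact le_of_mul_le_mul_left (ht.trans_eq (mul_left_comm _ _ _)) hs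
  exact step _ hcov

end Summit.QuantumFields.YangMills.Theorems.Prop7TransportedInterpolantAllMembers

end
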